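import Mathlib
import HarnessLib
import Summits.NavierStokesRegularity.NavierStokesRegularity.Theorems.TypeIQuarterGateScarEnvelopeTypeIForcedTsaiDefs

/-!
# ARM B — EXACT PART OF DATUM B-2j: Euler's identity kills the Leray drift on Type-I-homogeneous
  tails (ns-wall-extremal, eng-1 lineage g4, 2026-08-29)

WHAT IS PROVED (theorem-only file; elementary calculus).
* `fderiv_apply_self_of_homogeneous` — EULER'S IDENTITY along a ray: if `U (t • y) = t ^ k • U y`
  for all `t > 0` (`k : ℤ`) and `U` is differentiable at `y`, then `DU(y)[y] = k • U y`.  Stated for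
  maps between arbitrary real normed spaces.
* `leray_drift_eq_zero_of_homogeneous_neg_one` — for a field positively homogeneous of degree `−1`
  along the ray through `y` (the TYPE-I envelope `U(y) ~ |y|⁻¹` of PREREG-WALL-1 §B, taken exactly),
  the Leray drift vanishes: `½U(y) + ½DU(y)[y] = 0`; hence
  `lerayMomentumResidual_of_homogeneous_neg_one` : the registered momentum residual
  (`…ForcedTsaiDefs.lerayMomentumResidual`, `−ΔU + ½U + ½y·∇U + U·∇U`) of such a field IS the steady
  Navier–Stokes residual `−ΔU + (U·∇)U` at `y`, and `leray_profile_eq_iff_steadyNS_of_homogeneous` :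
  at such a point the Leray profile equation (`IsLerayProfile 1 ½`, NRŠ (1.4)) and the steady
  Navier–Stokes equation with the same pressure gradient are EQUIVALENT.
* `vorticity_drift_eq_zero_of_homogeneous_neg_two` — degree `−2` (the vorticity of a Type-I tail):
  `W(y) + ½DW(y)[y] = 0`, so the linearised vorticity operator `−Δ + 1 + ½y·∇` of DATUM B-2j acts on
  an exactly `(−2)`-homogeneous tail as `−Δ` alone (`linearisedVorticityOperator_of_homogeneous_neg_two`).

WHY THE CELL WANTS IT (DATUM B-2j, HOME/ARM-B/linfloor-eng1g4/LINEAR-FLOOR.md §3).  These identities are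
the exact content behind the «currency split»: on an exactly homogeneous Type-I tail the registered
residual density at order `|y|⁻⁴` is `curl(−ΔU_∞ + U_∞·∇U_∞)` — zero iff the tail solves the
homogeneous steady Navier–Stokes system (Landau solutions, Šverák 2011; Stokeslet at linear order),
log-divergent in the registered weight `(1+|y|)⁵` otherwise.  The analytic remark itself (Šverák's
classification) is NOT formalised here.

HONEST FRAME.  Pointwise calculus identities; no statement about the wall H3, crux
`ScarEnvelopeTypeI` (stmt-23843, OPEN) or Navier–Stokes regularity (NOT proved).  No definitions,
no notation, standard axioms.
-/

noncomputable section

set_option linter.dupNamespace false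

namespace Summit.NavierStokesRegularity.NavierStokesRegularity.Cruxes.ScarEnvelopeTypeI.ForcedTsai

open scoped Laplacian
open Literature.Analysis.FluidPDE Set Filter Topology

/-! ## Euler's identity along a ray -/

section Euler

variable {E F : Type*} [NormedAddCommGroup E] [NormedSpace ℝ E] [NormedAddCommGroup F]
  [NormedSpace ℝ F]

/-- **Euler's identity along a ray.** If `U (t • y) = t ^ k • U y` for every `t > 0` (positive
homogeneity of integer degree `k` along the ray through `y`) and `U` is differentiable at `y`, then
`DU(y)[y] = k • U(y)`. -/
theorem fderiv_apply_self_of_homogeneous {U : E → F} {y : E} (k : ℤ)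
    (hhom : ∀ t : ℝ, 0 < t → U (t • y) = (t ^ k) • U y) (hd : DifferentiableAt ℝ U y) :
    fderiv ℝ U y y = (k : ℝ) • U y := by
  -- derivative of `t ↦ U (t • y)` at `t = 1` by the chain rule
  have hs : HasDerivAt (fun t : ℝ => t • y) y 1 := by
    simpa using (hasDerivAt_id (1 : ℝ)).smul_const y
  have h1 : HasDerivAt (fun t : ℝ => U (t • y)) (fderiv ℝ U y y) 1 := by
    have hU : HasFDerivAt U (fderiv ℝ U y) ((fun t : ℝ => t • y) 1) := by
      simpa using hd.hasFDerivAt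
    exact hU.comp_hasDerivAt (1 : ℝ) hs
  -- derivative of `t ↦ t ^ k • U y` at `t = 1`
  have h2 : HasDerivAt (fun t : ℝ => (t ^ k) • U y) ((k : ℝ) • U y) 1 := by
    simpa using (hasDerivAt_zpow k (1 : ℝ) (Or.inl one_ne_zero)).smul_const (U y)
  -- the two functions agree on the neighbourhood `(0, ∞)` of `1`
  have heq : (fun t : ℝ => U (t • y)) =ᶠ[𝓝 (1 : ℝ)] fun t : ℝ => (t ^ k) • U y :=
    Filter.eventually_of_mem (Ioi_mem_nhds zero_lt_one) fun t ht => hhom t ht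
  exact h1.unique (h2.congr_of_eventuallyEq heq)

/-- Degree `−1` (the Type-I velocity envelope taken exactly): `DU(y)[y] = −U(y)`. -/
theorem fderiv_apply_self_of_homogeneous_neg_one {U : E → F} {y : E}
    (hhom : ∀ t : ℝ, 0 < t → U (t • y) = t⁻¹ • U y) (hd : DifferentiableAt ℝ U y) :
    fderiv ℝ U y y = -U y := by
  have h := fderiv_apply_self_of_homogeneous (U := U) (y := y) (-1)
    (fun t ht => by rw [hhom t ht, zpow_neg, zpow_one]) hd
  simpa using h

/-- Degree `−2` (the vorticity of a Type-I tail taken exactly): `DW(y)[y] = −2 W(y)`. -/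
theorem fderiv_apply_self_of_homogeneous_neg_two {W : E → F} {y : E}
    (hhom : ∀ t : ℝ, 0 < t → W (t • y) = (t ^ 2)⁻¹ • W y) (hd : DifferentiableAt ℝ W y) :
    fderiv ℝ W y y = -(2 : ℝ) • W y := by
  have h := fderiv_apply_self_of_homogeneous (U := W) (y := y) (-2)
    (fun t ht => by rw [hhom t ht, zpow_neg]; norm_cast) hd
  simpa using h

end Euler

/-! ## Consequences for the registered Leray currencies (`E3 = ℝ³`) -/

/-- **The Leray drift vanishes on a `(−1)`-homogeneous tail**: `½U(y) + ½DU(y)[y] = 0`. -/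
theorem leray_drift_eq_zero_of_homogeneous_neg_one {U : E3 → E3} {y : E3}
    (hhom : ∀ t : ℝ, 0 < t → U (t • y) = t⁻¹ • U y) (hd : DifferentiableAt ℝ U y) :
    (1 / 2 : ℝ) • U y + (1 / 2 : ℝ) • fderiv ℝ U y y = 0 := by
  rw [fderiv_apply_self_of_homogeneous_neg_one hhom hd, smul_neg, add_neg_cancel]

/-- **For a `(−1)`-homogeneous field the registered Leray momentum residual IS the steady
Navier–Stokes residual**: `lerayMomentumResidual U y = −ΔU(y) + (U·∇)U(y)`. -/
theorem lerayMomentumResidual_of_homogeneous_neg_one {U : E3 → E3} {y : E3}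
    (hhom : ∀ t : ℝ, 0 < t → U (t • y) = t⁻¹ • U y) (hd : DifferentiableAt ℝ U y) :
    lerayMomentumResidual U y = -((Δ U) y) + convect U U y := by
  have h := leray_drift_eq_zero_of_homogeneous_neg_one hhom hd
  have hsub : lerayMomentumResidual U y - (-((Δ U) y) + convect U U y)
      = (1 / 2 : ℝ) • U y + (1 / 2 : ℝ) • fderiv ℝ U y y := by
    rw [lerayMomentumResidual]; abel
  rw [h] at hsub
  exact sub_eq_zero.mp hsub

/-- **Leray profile equation ⟺ steady Navier–Stokes on a `(−1)`-homogeneous tail.** At a point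
where `U` is differentiable and homogeneous of degree `−1` along the ray, the profile equation of
`IsLerayProfile 1 ½` (NRŠ (1.4): `−ΔU + ½U + ½y·∇U + (U·∇)U + ∇P = 0`) holds iff the steady
Navier–Stokes equation `−ΔU + (U·∇)U + ∇P = 0` holds with the same pressure gradient.  (Landau's
`(−1)`-homogeneous steady solutions are therefore singular stationary Leray profiles away from
the origin; nothing more is claimed.) -/
theorem leray_profile_eq_iff_steadyNS_of_homogeneous {U : E3 → E3} {P : E3 → ℝ} {y : E3}
    (hhom : ∀ t : ℝ, 0 < t → U (t • y) = t⁻¹ • U y) (hd : DifferentiableAt ℝ U y) :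
    -((1 : ℝ) • (Δ U) y) + (1 / 2 : ℝ) • U y + (1 / 2 : ℝ) • fderiv ℝ U y y + convect U U y
        + gradient P y = 0 ↔
      -((Δ U) y) + convect U U y + gradient P y = 0 := by
  have h := leray_drift_eq_zero_of_homogeneous_neg_one hhom hd
  have : -((1 : ℝ) • (Δ U) y) + (1 / 2 : ℝ) • U y + (1 / 2 : ℝ) • fderiv ℝ U y y + convect U U y
      + gradient P y = -((Δ U) y) + convect U U y + gradient P y
        + ((1 / 2 : ℝ) • U y + (1 / 2 : ℝ) • fderiv ℝ U y y) := by
    rw [one_smul]; abel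
  rw [this, h, add_zero]

/-- **The vorticity drift `1 + ½y·∇` vanishes on a `(−2)`-homogeneous tail**:
`W(y) + ½DW(y)[y] = 0`. -/
theorem vorticity_drift_eq_zero_of_homogeneous_neg_two {W : E3 → E3} {y : E3}
    (hhom : ∀ t : ℝ, 0 < t → W (t • y) = (t ^ 2)⁻¹ • W y) (hd : DifferentiableAt ℝ W y) :
    W y + (1 / 2 : ℝ) • fderiv ℝ W y y = 0 := by
  rw [fderiv_apply_self_of_homogeneous_neg_two hhom hd, smul_smul,
    show (1 / 2 : ℝ) * -(2 : ℝ) = -1 by norm_num, neg_one_smul, add_neg_cancel]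

/-- **The linearised vorticity operator of DATUM B-2j, `A = −Δ + 1 + ½y·∇`, acts on an exactly
`(−2)`-homogeneous tail as `−Δ` alone**: `−ΔW(y) + W(y) + ½DW(y)[y] = −ΔW(y)`.  (So a Type-I
vorticity tail has registered linear residual density `|ΔW|`, of order `|y|⁻⁴` unless `W` is
harmonic there — the «currency split» of LINEAR-FLOOR.md §3.) -/
theorem linearisedVorticityOperator_of_homogeneous_neg_two {W : E3 → E3} {y : E3}
    (hhom : ∀ t : ℝ, 0 < t → W (t • y) = (t ^ 2)⁻¹ • W y) (hd : DifferentiableAt ℝ W y) :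
    -((Δ W) y) + W y + (1 / 2 : ℝ) • fderiv ℝ W y y = -((Δ W) y) := by
  rw [add_assoc, vorticity_drift_eq_zero_of_homogeneous_neg_two hhom hd, add_zero]

end Summit.NavierStokesRegularity.NavierStokesRegularity.Cruxes.ScarEnvelopeTypeI.ForcedTsai

end
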